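/-
Copyright: cell `pub-ymgap` (HUMAN RULING D-0062), Track A of `YM-PLAN.md`, DAG node N20 (= NE7b); R134 acceleration seat
`pub-ymgap-dag-n20-c` (strategy s1, generation 0).  Released under the licence of the surrounding project.
-/
import Summits.QuantumFields.BalabanUV.T4Continuum.Spine.NE7b.LocalPlaquetteExpMomentsAll
import Literature.MathematicalPhysics.QuantumFieldTheory.Balaban1983to89.T4AveragingDisintegration
import HarnessLib

/-!
# YM-DAG node N20 (= NE7b), strategy s1: «LCS-j» AT THE FIRST AVERAGED LEVEL — the push-forward reading of
# `LocalConditionalStability.LocCondStability` through the one-step disintegration transport, and the TRANSFER of the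
# tree's level-0 local exponential plaquette moments (`LocalPlaquetteExpMoments.localExpMoment`, (LS) rung 0) to every
# finite family of coarse observables dominated by the fine plaquette energies of their block regions

Track A of `YM-PLAN.md` (cell `pub-ymgap`, HUMAN RULING D-0062), node **N20** = spine estimate NE7b
(`T4WeightBudget.RelWeightBound` — the cell `pub-balaban`'s OWN estimate, NOT PRINTED in [Bałaban 1983–89], NOT PROVED).
Seat `pub-ymgap-dag-n20-c` (R134, strategy s1 «the `LocCondStability` INSTANCE for Bałaban's tower at a pinned 𝐑𝐓 step»).
Kernel theorems only: 0 `def`, 0 `sorry`, standard axioms; COUNT-NEUTRAL; `--supports` the K3 item `SpineGivenEndpointR11`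
(stmt-QuantumFields-19676).  Nothing of Bałaban's is asserted or instantiated.

ROW TRIAGE (why this file, honest).  The literal s1 row — an INHABITANT of the rows `lcsA ∕ lcsB`
(`Support/B16HistoryTowerExtractionStepDataLWR.TowerExtractionStepDataLWR` :265 ∕ :285, i.e. `LocCondStability` along the key patterns of
Bałaban's tower) — stays OBJECT-BOUND: it needs Bałaban's K-step 𝐑𝐓 recursion as a `B16HistoryReprChain.Tower` ((A1c); NC-NE7b-α
UNRULED; seat dag-n20-b `WALK-N20.md` v1.1 §3(c), seat dag-n20-a `HANDOFF` §3), and EVERY level-0 ∕ model inhabitant of «LCS-j» is already a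
tree theorem (`…NE7b.LocalPlaquetteExpMoments{,All,Even,Profile}` = (LS) rung 0, β-uniform, by chessboard + convexity + uniform torus
doubling; `…NE7b.CompactFibre*LCS`, `…NE7b.Gaussian*`, `…NE7b.CarrierOnSupport.locCondStability_of_carrier_le_on_support`).  What is NEW
and typable today is the FIRST RUNG ABOVE 0, push-forward half:

* §1 **THE PUSH-FORWARD READING** (kernel, any measurable averaging `avg : β → α` of a finite measure `ν` with `ν.map avg ≪ μ`; the
  currency of NODE 00's T-step of record, `Node00.TStepOfRecord.texpASucc = transportK …` = `T4AveragingDisintegration.kernelTransport`):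
  for a bounded measurable moment carrier `M` on the COARSE level and an integrable fine density `ρ`,
  `∫ M·(Tρ) dμ = ∫ (M ∘ avg)·ρ dν` (`integral_mul_kernelTransport`), hence the `LocCondStability` inequality AT AN AVERAGED LEVEL —
  `∫ M·(Tρ) dμ ≤ e^{b}·∫ (Tρ) dμ`, integrability conjunct included — is EQUIVALENT to the FINE-level moment bound
  `∫ (M ∘ avg)·ρ dν ≤ e^{b}·∫ ρ dν` (`integrable_mul_kernelTransport`, `lcs_coarse_of_fine`, `lcs_coarse_iff_fine`).  So «LCS-j» at the
  first averaged level, along the all-small history (whose term IS a plain transport `T(χ₀ρ₀)` — no 𝐑-quotient enters), is a statement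
  about the BARE fine measure: an exponential moment of the coarse carrier composed with the averaging map.
* §2 **THE TRANSFER (LS)₀ ⇒ (LS)₁** on the carriers of (LS) rung 0 (bare Wilson measure `wilsonMeasure r.ρ β` of a compact group `G`
  with a faithful continuous unitary lattice representation `r`, odd four-tori `(ℤ∕(2S+1))⁴`, `S ≥ 1`, `β ≥ 4`): for EVERY finite family of
  observables `O_P`, `P ∈ Q`, each dominated by the tilted fine plaquette energies of a finite region `R(P)` —
  `O_P(U) ≤ a·β·Σ_{q∈R(P)} A_q(U)`, `A_q = N − Re tr r(U_q) ≥ 0` — with regions of multiplicity `≤ m` and `m·a ≤ 1∕12`: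
  `∫ exp(Σ_{P∈Q} O_P) dμ_β ≤ exp(C·(m·a)·#(⋃_P R(P)))` with the constant `C` of `localExpMoment` (`localExpMoment_dominated`; ONE call of
  rung 0 after the multiplicity sum `sum_sum_le_mul_sum_biUnion`).  The domination letter a coarse plaquette energy naturally carries is
  TWO-REGIME — `O ≤ C₁·Σ_{R}A_q` where all `A_q ≤ α` (small fine fields: non-abelian Stokes + averaging spread), `O ≤ C₂` always (compact
  group) — and `twoRegime_le_mul_sum` turns it into the linear letter with `a = δ(C₁ + C₂∕α)` (the large-field branch pays for itself:
  `C₂ = (C₂∕α)·α < (C₂∕α)·A_{q₀}` at a fine plaquette `q₀` of the region exceeding `α`).  Headline **`localExpMoment_coarseObservables`**: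
  `∫ exp(δ·β·Σ_{P∈Q} O_P) dμ_β ≤ exp((C∕12)·n·#Q)` for regions of size `≤ n`, multiplicity `≤ m`, and `m·δ·(C₁ + C₂∕α) ≤ 1∕12` — local
  exponential moments of BLOCK observables (e.g. the plaquette energies `A_P(Ū)` of an averaged field `Ū = avg U`) under the bare Wilson
  measure, UNIFORMLY in `β ≥ 4` and in the volume, GIVEN the domination letter.  (LS) rung 0 is the case `Q` = plaquettes, `R(P) = {P}`.

LOCATED RESIDUALS (NOT claimed here; for dag-lead's «first missing» column).  (i) The domination letter for the coarse plaquette of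
Bałaban's block average of record (`Node00` `avOfRecord` ∕ `T4Averaging`): non-abelian Stokes (`…NE7b.NonAbelianStokesBound.dist1_hol_rectWord_le_sum`)
plus the spread of the averaged transporters on small fields — typed today in the 1-form currency only (`…NE7b.OneStepCoarseCurlBound`).
(ii) The CONDITIONAL form of level-1 «LCS-j» («in the history term's own state»: `ρ = χ₀·ρ₀` in §1) needs a chessboard ∕ uniform-doubling
estimate for the small-field-RESTRICTED Wilson measure — not in the tree; §2 is the unconditional moment.  (iii) The carrier junction
`GaugeConfig 4 (2S+1) G` (rung 0's odd torus) ↔ `T4Continuum.GaugeField (F.P K) 0 (SU N)` (NODE 00's level 0).  (iv) Levels `j ≥ 2` along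
histories with large-field regions need the (A1c) 𝐑-quotients.  NE7b NOT PRINTED ∕ NOT PROVED; (α)-instance 0∕1; N20 NOT discharged; typed
28∕28, discharged count untouched; one finite four-torus at fixed `ε` — NOT ℝ⁴, NOT infinite volume, NOT OS, NOT a mass gap, NOT Clay.
-/

set_option autoImplicit false

noncomputable section

namespace Summit.QuantumFields.YangMills.BalabanUVNodes.N20LCSPushforward

open MeasureTheory
open Literature.MathematicalPhysics.QuantumFieldTheory
open Literature.MathematicalPhysics.QuantumFieldTheory.Balaban1983to89.T4AveragingDisintegration
  (kernelTransport integral_kernelTransport_mul integrable_kernelTransport)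
open Summit.QuantumFields.BalabanUV.T4Continuum.NE7b.LocalPlaquetteExpMoments
  (localExpMoment plaqEnergy_nonneg plaqEnergy_le integrable_exp_of_abs_le)

/-! ## §1 «LCS-j» at an averaged level IS a fine-level moment: the push-forward reading of the disintegration transport -/

section Pushforward

variable {α β : Type*} [MeasurableSpace α] [MeasurableSpace β] [StandardBorelSpace β] [Nonempty β]
  (ν : Measure β) [IsFiniteMeasure ν] (μ : Measure α) [SigmaFinite μ] {avg : β → α}

/-- **A COARSE CARRIER AGAINST A TRANSPORTED DENSITY IS THE COMPOSED CARRIER AGAINST THE FINE DENSITY**: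
`∫ M(V)·(Tρ)(V) dμ(V) = ∫ M(avg U)·ρ(U) dν(U)` for the one-step disintegration transport `T = kernelTransport ν μ avg` (marginal density ×
conditional law of the fine field), `ρ` integrable, `M` bounded measurable — the push-forward identity `integral_kernelTransport_mul`
read with the carrier on the left. [folklore] -/
theorem integral_mul_kernelTransport (havg : Measurable avg) (hac : ν.map avg ≪ μ) {ρ : β → ℝ} (hρ : Integrable ρ ν)
    {M : α → ℝ} (hM : Measurable M) {C : ℝ} (hC : ∀ V, |M V| ≤ C) :
    ∫ V, M V * kernelTransport ν μ avg ρ V ∂μ = ∫ U, M (avg U) * ρ U ∂ν := by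
  have e1 : (fun V => M V * kernelTransport ν μ avg ρ V) = fun V => kernelTransport ν μ avg ρ V * M V :=
    funext fun V => mul_comm _ _
  have e2 : (fun U => M (avg U) * ρ U) = fun U => ρ U * M (avg U) := funext fun U => mul_comm _ _
  rw [e1, e2]
  exact integral_kernelTransport_mul ν μ havg hac hρ hM hC

/-- The total mass is transported: `∫ (Tρ) dμ = ∫ ρ dν` ([Balaban1989LargeFieldI] (0.4) p. 176 — locator; the push-forward identity at
the test function `1`). [folklore] -/
theorem integral_kernelTransport_eq (havg : Measurable avg) (hac : ν.map avg ≪ μ) {ρ : β → ℝ} (hρ : Integrable ρ ν) :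
    ∫ V, kernelTransport ν μ avg ρ V ∂μ = ∫ U, ρ U ∂ν := by
  have h := integral_kernelTransport_mul ν μ havg hac hρ (f := fun _ => (1 : ℝ)) measurable_const (C := 1)
    (fun _ => by simp)
  simpa only [mul_one] using h

/-- **THE INTEGRABILITY CONJUNCT** of `LocCondStability` at an averaged level: a bounded measurable coarse carrier times a transported
integrable density is integrable. [folklore] -/
theorem integrable_mul_kernelTransport (havg : Measurable avg) (hac : ν.map avg ≪ μ) {ρ : β → ℝ} (hρ : Integrable ρ ν)
    {M : α → ℝ} (hM : Measurable M) {C : ℝ} (hC : ∀ V, |M V| ≤ C) :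
    Integrable (fun V => M V * kernelTransport ν μ avg ρ V) μ := by
  have h := (integrable_kernelTransport ν μ havg hac hρ).bdd_mul hM.aestronglyMeasurable
    (Filter.Eventually.of_forall (fun V => show ‖M V‖ ≤ C by rw [Real.norm_eq_abs]; exact hC V))
  exact h

/-- **«LCS-j» AT AN AVERAGED LEVEL FROM A FINE-LEVEL MOMENT.**  If the composed carrier `M ∘ avg` has exponential-size moment `≤ e^{b}`
against the fine density `ρ` — `∫ M(avg U)·ρ(U) dν ≤ e^{b}·∫ ρ dν` — then the `LocCondStability` inequality holds at the averaged level for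
the transported term: `∫ M·(Tρ) dμ ≤ e^{b}·∫ (Tρ) dμ`, together with its integrability conjunct.  For Bałaban's tower this reads: along the
all-small history, whose level-1 term IS the transport `T(χ₀ρ₀)` of the restricted initial density (NODE 00's T-step of record), local
conditional stability of the sacrificed coarse action part `M = e^{δQ_{1,Z}}` is a conditional exponential moment of `Q_{1,Z} ∘ avg` under the
BARE fine measure restricted by `χ₀`. [folklore] -/
theorem lcs_coarse_of_fine (havg : Measurable avg) (hac : ν.map avg ≪ μ) {ρ : β → ℝ} (hρ : Integrable ρ ν)
    {M : α → ℝ} (hM : Measurable M) {C : ℝ} (hC : ∀ V, |M V| ≤ C) {b : ℝ}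
    (hfine : ∫ U, M (avg U) * ρ U ∂ν ≤ Real.exp b * ∫ U, ρ U ∂ν) :
    Integrable (fun V => M V * kernelTransport ν μ avg ρ V) μ ∧
      ∫ V, M V * kernelTransport ν μ avg ρ V ∂μ ≤ Real.exp b * ∫ V, kernelTransport ν μ avg ρ V ∂μ := by
  refine ⟨integrable_mul_kernelTransport ν μ havg hac hρ hM hC, ?_⟩
  rw [integral_mul_kernelTransport ν μ havg hac hρ hM hC, integral_kernelTransport_eq ν μ havg hac hρ]
  exact hfine

/-- **THE EQUIVALENCE**: at an averaged level whose term is a transported density, the `LocCondStability` inequality for a bounded measurable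
coarse carrier `M` IS the fine-level moment bound for `M ∘ avg` (both sides are literally equal). [folklore] -/
theorem lcs_coarse_iff_fine (havg : Measurable avg) (hac : ν.map avg ≪ μ) {ρ : β → ℝ} (hρ : Integrable ρ ν)
    {M : α → ℝ} (hM : Measurable M) {C : ℝ} (hC : ∀ V, |M V| ≤ C) (b : ℝ) :
    ∫ V, M V * kernelTransport ν μ avg ρ V ∂μ ≤ Real.exp b * ∫ V, kernelTransport ν μ avg ρ V ∂μ ↔
      ∫ U, M (avg U) * ρ U ∂ν ≤ Real.exp b * ∫ U, ρ U ∂ν := by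
  rw [integral_mul_kernelTransport ν μ havg hac hρ hM hC, integral_kernelTransport_eq ν μ havg hac hρ]

end Pushforward

/-! ## §2 The transfer (LS)₀ ⇒ (LS)₁: local exponential moments of dominated coarse observables under the bare Wilson measure -/

section Pointwise

/-- **THE TWO-REGIME DOMINATION LETTER GIVES THE LINEAR ONE.**  If an observable `O` is at most `C₁·Σ_{q∈R} A_q` whenever every fine energy
of its region is `≤ α` (small fields) and at most `C₂` always, with `A_q ≥ 0` on the region and `α > 0`, then `O ≤ (C₁ + C₂∕α)·Σ_{q∈R} A_q`
UNCONDITIONALLY: in the large-field branch a plaquette `q₀` of the region with `A_{q₀} > α` pays `C₂ = (C₂∕α)·α ≤ (C₂∕α)·A_{q₀}`. [folklore] -/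
theorem twoRegime_le_mul_sum {ι : Type*} (R : Finset ι) (A : ι → ℝ) (hA0 : ∀ q ∈ R, 0 ≤ A q)
    {O α C₁ C₂ : ℝ} (hα : 0 < α) (hC₁ : 0 ≤ C₁) (hC₂ : 0 ≤ C₂)
    (hsmall : (∀ q ∈ R, A q ≤ α) → O ≤ C₁ * ∑ q ∈ R, A q) (hlarge : O ≤ C₂) :
    O ≤ (C₁ + C₂ / α) * ∑ q ∈ R, A q := by
  have hS0 : 0 ≤ ∑ q ∈ R, A q := Finset.sum_nonneg hA0
  by_cases h : ∀ q ∈ R, A q ≤ α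
  · calc O ≤ C₁ * ∑ q ∈ R, A q := hsmall h
      _ ≤ (C₁ + C₂ / α) * ∑ q ∈ R, A q := by
          have : 0 ≤ C₂ / α * ∑ q ∈ R, A q := mul_nonneg (div_nonneg hC₂ hα.le) hS0
          nlinarith
  · push Not at h
    obtain ⟨q₀, hq₀, hq₀α⟩ := h
    have h1 : A q₀ ≤ ∑ q ∈ R, A q := Finset.single_le_sum hA0 hq₀
    have h2 : C₂ ≤ C₂ / α * A q₀ := by
      rw [div_mul_eq_mul_div, le_div_iff₀ hα]
      exact mul_le_mul_of_nonneg_left hq₀α.le hC₂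
    calc O ≤ C₂ := hlarge
      _ ≤ C₂ / α * ∑ q ∈ R, A q := h2.trans (mul_le_mul_of_nonneg_left h1 (div_nonneg hC₂ hα.le))
      _ ≤ (C₁ + C₂ / α) * ∑ q ∈ R, A q := by nlinarith

/-- The exponential form of `twoRegime_le_mul_sum` with the tilt `δ·β` (`δ, β ≥ 0`):
`exp(δβ·O) ≤ exp(δ(C₁ + C₂∕α)·β·Σ_{q∈R} A_q)`. [folklore] -/
theorem exp_twoRegime_le {ι : Type*} (R : Finset ι) (A : ι → ℝ) (hA0 : ∀ q ∈ R, 0 ≤ A q)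
    {O α C₁ C₂ δ β : ℝ} (hα : 0 < α) (hC₁ : 0 ≤ C₁) (hC₂ : 0 ≤ C₂) (hδ : 0 ≤ δ) (hβ : 0 ≤ β)
    (hsmall : (∀ q ∈ R, A q ≤ α) → O ≤ C₁ * ∑ q ∈ R, A q) (hlarge : O ≤ C₂) :
    Real.exp (δ * β * O) ≤ Real.exp (δ * (C₁ + C₂ / α) * β * ∑ q ∈ R, A q) := by
  refine Real.exp_le_exp.2 ?_
  have h := twoRegime_le_mul_sum R A hA0 hα hC₁ hC₂ hsmall hlarge
  have hδβ : 0 ≤ δ * β := mul_nonneg hδ hβ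
  calc δ * β * O ≤ δ * β * ((C₁ + C₂ / α) * ∑ q ∈ R, A q) := mul_le_mul_of_nonneg_left h hδβ
    _ = δ * (C₁ + C₂ / α) * β * ∑ q ∈ R, A q := by ring

/-- **THE MULTIPLICITY SUM**: if every point of `⋃_{P∈Q} R(P)` lies in at most `m` of the regions, then for `f ≥ 0` there
`Σ_{P∈Q} Σ_{q∈R(P)} f q ≤ m·Σ_{q∈⋃R} f q`. [folklore] -/
theorem sum_sum_le_mul_sum_biUnion {κ ι : Type*} [DecidableEq ι] (Q : Finset κ) (R : κ → Finset ι) (f : ι → ℝ)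
    (hf : ∀ q ∈ Q.biUnion R, 0 ≤ f q) (m : ℕ) (hm : ∀ q ∈ Q.biUnion R, (Q.filter fun P => q ∈ R P).card ≤ m) :
    ∑ P ∈ Q, ∑ q ∈ R P, f q ≤ m * ∑ q ∈ Q.biUnion R, f q := by
  classical
  set B := Q.biUnion R with hB
  -- each inner sum is a sum over `B` with an indicator
  have hinner : ∀ P ∈ Q, ∑ q ∈ R P, f q = ∑ q ∈ B, if q ∈ R P then f q else 0 := by
    intro P hP
    have hsub : R P ⊆ B := Finset.subset_biUnion_of_mem R hP
    rw [← Finset.sum_filter, Finset.filter_mem_eq_inter, Finset.inter_eq_right.2 hsub]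
  rw [Finset.sum_congr rfl hinner, Finset.sum_comm, Finset.mul_sum]
  refine Finset.sum_le_sum fun q hq => ?_
  rw [← Finset.sum_filter, Finset.sum_const, nsmul_eq_mul]
  exact mul_le_mul_of_nonneg_right (by exact_mod_cast hm q hq) (hf q hq)

end Pointwise

section Transfer

variable {G : Type} [Group G] [TopologicalSpace G] [IsTopologicalGroup G] [CompactSpace G]
  [MeasurableSpace G] [BorelSpace G]

/-- **THE TRANSFER (LS)₀ ⇒ (LS)₁ — LOCAL EXPONENTIAL MOMENTS OF DOMINATED OBSERVABLES.**  For a faithful continuous unitary lattice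
representation `r` of a compact group `G` there is `C ≥ 0` (the constant of `localExpMoment`) such that for every odd four-torus
`(ℤ∕(2S+1))⁴`, `S ≥ 1`, every `β ≥ 4`, every finite family `O_P` (`P ∈ Q`) of observables with finite regions `R(P)` of plaquettes of
multiplicity `≤ m`, and every tilt `a ≥ 0` with `m·a ≤ 1∕12`: if `O_P(U) ≤ a·β·Σ_{q∈R(P)} (N − Re tr r(U_q))` for all `P ∈ Q` and all `U`, then
`∫ exp(Σ_{P∈Q} O_P(U)) dμ_β ≤ exp(C·(m·a)·#(⋃_{P∈Q} R(P)))`.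
Proof: the pointwise domination, the multiplicity sum, ONE call of (LS) rung 0 at the tilt `m·a` on the plaquette set `⋃R`. [folklore] -/
theorem localExpMoment_dominated (r : LatticeRep G) :
    ∃ C : ℝ, 0 ≤ C ∧ ∀ (S : ℕ), 1 ≤ S → ∀ (β : ℝ), 4 ≤ β →
      ∀ (κ : Type) (Q : Finset κ) (R : κ → Finset (Plaquette 4 (2 * S + 1)))
        (O : κ → GaugeConfig 4 (2 * S + 1) G → ℝ) (a : ℝ) (m : ℕ), 0 ≤ a → (m : ℝ) * a ≤ 1 / 12 →
        (∀ q ∈ Q.biUnion R, (Q.filter fun P => q ∈ R P).card ≤ m) →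
        (∀ P ∈ Q, ∀ U : GaugeConfig 4 (2 * S + 1) G,
          O P U ≤ a * β * ∑ q ∈ R P, ((r.N : ℝ) - WilsonRP.plaqRe r.ρ U q)) →
        ∫ U, Real.exp (∑ P ∈ Q, O P U) ∂(wilsonMeasure r.ρ β : Measure (GaugeConfig 4 (2 * S + 1) G)) ≤
          Real.exp (C * (m * a) * (Q.biUnion R).card) := by
  obtain ⟨C, hC0, hC⟩ := localExpMoment r
  refine ⟨C, hC0, fun S hS β hβ κ Q R O a m ha hma hmult hdom => ?_⟩
  classical
  haveI hprob := isProbabilityMeasure_wilsonMeasure (d := 4) (L := 2 * S + 1) (G := G) r.ρ r.continuous β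
  set μ : Measure (GaugeConfig 4 (2 * S + 1) G) := wilsonMeasure r.ρ β with hμ
  set X : Finset (Plaquette 4 (2 * S + 1)) := Q.biUnion R with hX
  have hβ0 : 0 ≤ β := by linarith
  have hma0 : 0 ≤ (m : ℝ) * a := mul_nonneg (Nat.cast_nonneg m) ha
  -- pointwise: `Σ_P O_P ≤ (m a) β Σ_{q∈X} A_q`
  have hpt : ∀ U : GaugeConfig 4 (2 * S + 1) G,
      ∑ P ∈ Q, O P U ≤ (m * a) * β * ∑ q ∈ X, ((r.N : ℝ) - WilsonRP.plaqRe r.ρ U q) := by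
    intro U
    have h1 : ∑ P ∈ Q, O P U ≤ ∑ P ∈ Q, a * β * ∑ q ∈ R P, ((r.N : ℝ) - WilsonRP.plaqRe r.ρ U q) :=
      Finset.sum_le_sum fun P hP => hdom P hP U
    have h2 : ∑ P ∈ Q, ∑ q ∈ R P, ((r.N : ℝ) - WilsonRP.plaqRe r.ρ U q) ≤
        m * ∑ q ∈ X, ((r.N : ℝ) - WilsonRP.plaqRe r.ρ U q) :=
      sum_sum_le_mul_sum_biUnion Q R _ (fun q _ => plaqEnergy_nonneg r.ρ r.continuous U q) m hmult
    rw [← Finset.mul_sum] at h1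
    have hab : 0 ≤ a * β := mul_nonneg ha hβ0
    calc ∑ P ∈ Q, O P U ≤ a * β * ∑ P ∈ Q, ∑ q ∈ R P, ((r.N : ℝ) - WilsonRP.plaqRe r.ρ U q) := h1
      _ ≤ a * β * (m * ∑ q ∈ X, ((r.N : ℝ) - WilsonRP.plaqRe r.ρ U q)) := mul_le_mul_of_nonneg_left h2 hab
      _ = (m * a) * β * ∑ q ∈ X, ((r.N : ℝ) - WilsonRP.plaqRe r.ρ U q) := by ring
  -- the dominating exponential is integrable (bounded measurable observable, probability measure)
  have hint : Integrable (fun U => Real.exp ((m * a) * β * ∑ q ∈ X, ((r.N : ℝ) - WilsonRP.plaqRe r.ρ U q))) μ := by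
    refine integrable_exp_of_abs_le r.ρ r.continuous β
      ((Finset.measurable_sum X fun p _ =>
        measurable_const.sub (WilsonRP.measurable_plaqRe r.ρ r.continuous p)).const_mul ((m * a) * β))
      (B := |(m : ℝ) * a * β| * (2 * r.N * X.card)) fun U => ?_
    rw [abs_mul]
    refine mul_le_mul_of_nonneg_left ?_ (abs_nonneg _)
    rw [abs_of_nonneg (Finset.sum_nonneg fun p _ => plaqEnergy_nonneg r.ρ r.continuous U p)]
    calc ∑ p ∈ X, ((r.N : ℝ) - WilsonRP.plaqRe r.ρ U p) ≤ ∑ _p ∈ X, (2 * (r.N : ℝ)) :=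
          Finset.sum_le_sum fun p _ => plaqEnergy_le r.ρ r.continuous U p
      _ = 2 * r.N * X.card := by rw [Finset.sum_const, nsmul_eq_mul]; ring
  -- integrate and call rung 0 at the tilt `m a` on `X`
  calc ∫ U, Real.exp (∑ P ∈ Q, O P U) ∂μ
      ≤ ∫ U, Real.exp ((m * a) * β * ∑ q ∈ X, ((r.N : ℝ) - WilsonRP.plaqRe r.ρ U q)) ∂μ :=
        integral_mono_of_nonneg (ae_of_all _ fun U => (Real.exp_pos _).le) hint
          (ae_of_all _ fun U => Real.exp_le_exp.2 (hpt U))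
    _ ≤ Real.exp (C * (m * a) * X.card) := hC S hS β hβ (m * a) hma0 hma X

/-- The biUnion of regions of size `≤ n` over `Q` has at most `n·#Q` points. [folklore] -/
theorem card_biUnion_le_mul {κ ι : Type*} [DecidableEq ι] (Q : Finset κ) (R : κ → Finset ι) (n : ℕ)
    (hn : ∀ P ∈ Q, (R P).card ≤ n) : (Q.biUnion R).card ≤ n * Q.card := by
  calc (Q.biUnion R).card ≤ ∑ P ∈ Q, (R P).card := Finset.card_biUnion_le
    _ ≤ ∑ _P ∈ Q, n := Finset.sum_le_sum hn
    _ = n * Q.card := by rw [Finset.sum_const, smul_eq_mul, mul_comm]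

/-- **(LS) AT THE FIRST AVERAGED LEVEL, PUSH-FORWARD FORM, FOR EVERY FAMILY OF COARSE OBSERVABLES CARRYING THE TWO-REGIME DOMINATION
LETTER.**  For a faithful continuous unitary lattice representation `r` of a compact group `G` there is `C ≥ 0` such that for every odd
four-torus `(ℤ∕(2S+1))⁴` (`S ≥ 1`), every `β ≥ 4`, every finite family `O_P` (`P ∈ Q`) with finite regions `R(P)` of at most `n` plaquettes
and multiplicity `≤ m`, every `α > 0`, `C₁, C₂, δ ≥ 0` with `m·δ·(C₁ + C₂∕α) ≤ 1∕12`, IF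
(small fields) `(∀ q ∈ R(P), A_q(U) ≤ α) → O_P(U) ≤ C₁·Σ_{q∈R(P)} A_q(U)` and (always) `O_P(U) ≤ C₂`, `A_q = N − Re tr r(U_q)`, THEN
`∫ exp(δ·β·Σ_{P∈Q} O_P(U)) dμ_β ≤ exp((C∕12)·n·#Q)` — uniformly in `β ≥ 4` and in the volume.  With `O_P(U) := A_P(avg U)` the plaquette
energies of a block-averaged field, this is the local exponential moment bound for BLOCK plaquette energies under the bare Wilson measure
((LS) of route NE7b R-T1 at scale `j = 1`, push-forward form), GIVEN the domination letter for the averaging (located, not asserted).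
[folklore] -/
theorem localExpMoment_coarseObservables (r : LatticeRep G) :
    ∃ C : ℝ, 0 ≤ C ∧ ∀ (S : ℕ), 1 ≤ S → ∀ (β : ℝ), 4 ≤ β →
      ∀ (κ : Type) (Q : Finset κ) (R : κ → Finset (Plaquette 4 (2 * S + 1)))
        (O : κ → GaugeConfig 4 (2 * S + 1) G → ℝ) (α C₁ C₂ δ : ℝ) (m n : ℕ),
        0 < α → 0 ≤ C₁ → 0 ≤ C₂ → 0 ≤ δ → (m : ℝ) * (δ * (C₁ + C₂ / α)) ≤ 1 / 12 →
        (∀ q ∈ Q.biUnion R, (Q.filter fun P => q ∈ R P).card ≤ m) → (∀ P ∈ Q, (R P).card ≤ n) →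
        (∀ P ∈ Q, ∀ U : GaugeConfig 4 (2 * S + 1) G,
          (∀ q ∈ R P, ((r.N : ℝ) - WilsonRP.plaqRe r.ρ U q) ≤ α) →
            O P U ≤ C₁ * ∑ q ∈ R P, ((r.N : ℝ) - WilsonRP.plaqRe r.ρ U q)) →
        (∀ P ∈ Q, ∀ U : GaugeConfig 4 (2 * S + 1) G, O P U ≤ C₂) →
        ∫ U, Real.exp (δ * β * ∑ P ∈ Q, O P U) ∂(wilsonMeasure r.ρ β : Measure (GaugeConfig 4 (2 * S + 1) G)) ≤
          Real.exp (C / 12 * (n * Q.card)) := by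
  obtain ⟨C, hC0, hC⟩ := localExpMoment_dominated r
  refine ⟨C, hC0, fun S hS β hβ κ Q R O α C₁ C₂ δ m n hα hC₁ hC₂ hδ hsmall hmult hn hdom hbd => ?_⟩
  classical
  have hβ0 : 0 ≤ β := by linarith
  have ha : 0 ≤ δ * (C₁ + C₂ / α) := mul_nonneg hδ (add_nonneg hC₁ (div_nonneg hC₂ hα.le))
  -- the tilted observables `δβ·O_P` carry the linear letter with `a = δ(C₁ + C₂/α)`
  have hdom' : ∀ P ∈ Q, ∀ U : GaugeConfig 4 (2 * S + 1) G,
      δ * β * O P U ≤ δ * (C₁ + C₂ / α) * β * ∑ q ∈ R P, ((r.N : ℝ) - WilsonRP.plaqRe r.ρ U q) := by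
    intro P hP U
    have h := twoRegime_le_mul_sum (R P) (fun q => (r.N : ℝ) - WilsonRP.plaqRe r.ρ U q)
      (fun q _ => plaqEnergy_nonneg r.ρ r.continuous U q) hα hC₁ hC₂ (hdom P hP U) (hbd P hP U)
    have hδβ : 0 ≤ δ * β := mul_nonneg hδ hβ0
    calc δ * β * O P U ≤ δ * β * ((C₁ + C₂ / α) * ∑ q ∈ R P, ((r.N : ℝ) - WilsonRP.plaqRe r.ρ U q)) :=
          mul_le_mul_of_nonneg_left h hδβ
      _ = δ * (C₁ + C₂ / α) * β * ∑ q ∈ R P, ((r.N : ℝ) - WilsonRP.plaqRe r.ρ U q) := by ring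
  have hmain := hC S hS β hβ κ Q R (fun P U => δ * β * O P U) (δ * (C₁ + C₂ / α)) m ha hsmall hmult hdom'
  have hsum : ∀ U : GaugeConfig 4 (2 * S + 1) G, ∑ P ∈ Q, δ * β * O P U = δ * β * ∑ P ∈ Q, O P U :=
    fun U => by rw [Finset.mul_sum]
  simp_rw [hsum] at hmain
  refine hmain.trans (Real.exp_le_exp.2 ?_)
  have hcard : ((Q.biUnion R).card : ℝ) ≤ n * Q.card := by exact_mod_cast card_biUnion_le_mul Q R n hn
  calc C * (m * (δ * (C₁ + C₂ / α))) * ((Q.biUnion R).card : ℝ)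
      ≤ C * (1 / 12) * (n * Q.card) := by
        have h1 : C * (m * (δ * (C₁ + C₂ / α))) ≤ C * (1 / 12) := mul_le_mul_of_nonneg_left hsmall hC0
        have h2 : 0 ≤ C * (m * (δ * (C₁ + C₂ / α))) := mul_nonneg hC0 (mul_nonneg (Nat.cast_nonneg m) ha)
        calc C * (m * (δ * (C₁ + C₂ / α))) * ((Q.biUnion R).card : ℝ)
            ≤ C * (m * (δ * (C₁ + C₂ / α))) * (n * Q.card) := mul_le_mul_of_nonneg_left hcard h2
          _ ≤ C * (1 / 12) * (n * Q.card) := mul_le_mul_of_nonneg_right h1 (by positivity)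
    _ = C / 12 * (n * Q.card) := by ring

/-- **THE BLOCK-MAP INSTANCE SHAPE.**  For ANY map `Φ` from the fine configurations to the configurations of another four-torus
`(ℤ∕L′)⁴` (a block averaging, say) whose coarse plaquette energies `A_P(Φ U) = N − Re tr r((Φ U)_P)` carry the small-field domination
letter `(∀ q ∈ R(P), A_q(U) ≤ α) → A_P(Φ U) ≤ C₁·Σ_{q∈R(P)} A_q(U)` on regions of size `≤ n` and multiplicity `≤ m`, with
`m·δ·(C₁ + 2N∕α) ≤ 1∕12`: `∫ exp(δ·β·Σ_{P∈Q} A_P(Φ U)) dμ_β ≤ exp((C∕12)·n·#Q)` for every finite set `Q` of coarse plaquettes, every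
`β ≥ 4`, every odd fine torus — the large-field branch is free (`A_P ≤ 2N` on a unitary representation).  This is the statement (LS) of
route NE7b R-T1 at scale `j = 1` in push-forward form, CONDITIONAL on the domination letter of the block map (located residual (i));
by §1 it is the `LocCondStability` inequality at level 1 for the carrier `e^{δβ Σ_{P∈Q} A_P}` against the UNRESTRICTED transported
density (the restricted ∕ conditional form is located residual (ii)). [folklore] -/
theorem localExpMoment_blockMap (r : LatticeRep G) :
    ∃ C : ℝ, 0 ≤ C ∧ ∀ (S : ℕ), 1 ≤ S → ∀ (β : ℝ), 4 ≤ β → ∀ (L' : ℕ) [NeZero L']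
      (Φ : GaugeConfig 4 (2 * S + 1) G → GaugeConfig 4 L' G)
      (Q : Finset (Plaquette 4 L')) (R : Plaquette 4 L' → Finset (Plaquette 4 (2 * S + 1)))
      (α C₁ δ : ℝ) (m n : ℕ), 0 < α → 0 ≤ C₁ → 0 ≤ δ → (m : ℝ) * (δ * (C₁ + 2 * r.N / α)) ≤ 1 / 12 →
      (∀ q ∈ Q.biUnion R, (Q.filter fun P => q ∈ R P).card ≤ m) → (∀ P ∈ Q, (R P).card ≤ n) →
      (∀ P ∈ Q, ∀ U : GaugeConfig 4 (2 * S + 1) G,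
        (∀ q ∈ R P, ((r.N : ℝ) - WilsonRP.plaqRe r.ρ U q) ≤ α) →
          ((r.N : ℝ) - WilsonRP.plaqRe r.ρ (Φ U) P) ≤ C₁ * ∑ q ∈ R P, ((r.N : ℝ) - WilsonRP.plaqRe r.ρ U q)) →
      ∫ U, Real.exp (δ * β * ∑ P ∈ Q, ((r.N : ℝ) - WilsonRP.plaqRe r.ρ (Φ U) P))
          ∂(wilsonMeasure r.ρ β : Measure (GaugeConfig 4 (2 * S + 1) G)) ≤
        Real.exp (C / 12 * (n * Q.card)) := by
  obtain ⟨C, hC0, hC⟩ := localExpMoment_coarseObservables r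
  refine ⟨C, hC0, fun S hS β hβ L' _ Φ Q R α C₁ δ m n hα hC₁ hδ hsmall hmult hn hdom => ?_⟩
  exact hC S hS β hβ (Plaquette 4 L') Q R (fun P U => (r.N : ℝ) - WilsonRP.plaqRe r.ρ (Φ U) P) α C₁ (2 * r.N) δ m n
    hα hC₁ (by positivity) hδ hsmall hmult hn hdom (fun P _ U => plaqEnergy_le r.ρ r.continuous (Φ U) P)

end Transfer

end Summit.QuantumFields.YangMills.BalabanUVNodes.N20LCSPushforward

end
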